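import Summits.HodgeConjecture.HodgeConjecture.Theorems.EightfoldBlochSeedsDefs
import Summits.HodgeConjecture.HodgeConjecture.Theorems.EightfoldBlochSeedsBlochSeedsGenericPad4CarrierOfKleimanSmoothing
import HarnessLib

/-!
# Route `EightfoldBlochSeeds`, cruxes `BlochSeedsGeneric` (stmt-HodgeConjecture-18880) / `BlochSeedDiscThree` (18882), line
# `pad4-cm-anchor`: the registered stub `stub_pad4_carrier` IN ITS OWN SIGNATURE, modulo Kleiman's smoothing of cycles

HONEST FRAMING. CONDITIONAL support file (`--supports stmt-HodgeConjecture-18880 --as helper`). The two theorems below have —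
after the one hypothesis `hKL : Literature.AlgebraicGeometry.HodgeTheory.kleiman1969_smoothingCycles_eightfold_codimFour` (NAMED
FACT, unproved in the tree: Kleiman 1969 §5 / Fulton Ex. 15.3.2 with Fulton–Lazarsfeld connectedness) — LITERALLY the registered
signatures of `stub_pad4_carrier` of `Cruxes/BlochSeedsGeneric/Lines/pad4_cm_anchor.lean` (fb115e60acaf2337, every `d`) and of
`Cruxes/BlochSeedDiscThree/Lines/pad4_cm_anchor.lean` (d208bf462bd6e07f, `d = 3`), written in the Theorems-side copy of the
skeletons' vocabulary (`Theorems/EightfoldBlochSeedsDefs.lean` §3: `pad4Anchor`, `pad4Action`, `symH`, `HasLciCarrierAt`, verbatim).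
So the kernel certifies that `Theorems.exists_pad4_carrier_stubShape_of_kleimanSmoothing` IS the stub's body (the abbreviations and
`HasLciCarrierAt` unfold by `rfl`), and the day `kleiman1969_smoothingCycles_eightfold_codimFour_holds` lands the by-name close of the
carrier stub (both items; also the `d = 1` line's l.205) is the one-liner `stub_pad4_carrier_of_kleimanSmoothing that_theorem`.
They do NOT close the stubs today (the hypothesis is open), do not touch the RUNG `stub_rung_pad4_seedAt` (Bloch semiregularity),
and prove nothing toward 18880/18882/H2/HC_AV/HC. No definition, no sorry.

References: [cite: Kleiman1969Grassmannians, §5] [cite: Fulton1998, Example 15.3.2 and §19.1] [cite: FultonLazarsfeld1981, Thm. 1.1 (b)]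
[cite: Bloch1972Semiregularity, Remark (7.5)]
-/

noncomputable section

-- single-problem summit (Problem = Summit): the mandated namespace repeats `HodgeConjecture`.
set_option linter.dupNamespace false

open CategoryTheory AlgebraicGeometry
open Literature.AlgebraicGeometry Literature.AlgebraicGeometry.Motives Literature.AlgebraicGeometry.HodgeTheory
open Literature.AlgebraicTopology.SingularHomology
open Summit.HodgeConjecture.HodgeConjecture.Theorems.EightfoldBlochSeeds

namespace Summit.HodgeConjecture.HodgeConjecture.Theorems

/-- **`stub_pad4_carrier` (crux `BlochSeedsGeneric`, every `d ≥ 1`, every CM datum) MODULO KLEIMAN'S SMOOTHING**, in the stub's own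
signature: a projective embedding `e` of `S⁴(E₀)`, a rational `a ≠ 0`, a non-zero rational class `w` of the Weil plane of
`(S⁴, (ψ₀ × (−ψ₀))⁴)`, and an lci carrier `HasLciCarrierAt 4 S⁴ h_K w` of `q·h_K⁴ + w`, `h_K = symH d Ψ e a`. One line from
`exists_pad4_carrier_stubShape_of_kleimanSmoothing` (Tate–Murasaki at the anchor, the tree's `K`-symmetric Segre embedding, and the
named fact). [cite: Kleiman1969Grassmannians, §5] [cite: Fulton1998, Example 15.3.2] [cite: Bloch1972Semiregularity, Remark (7.5)] -/
theorem stub_pad4_carrier_of_kleimanSmoothing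
    (hKL : Literature.AlgebraicGeometry.HodgeTheory.kleiman1969_smoothingCycles_eightfold_codimFour)
    (d : ℕ) (hd : 0 < d) (E₀ : AbelianVariety ℂ) (ψ₀ : E₀ ⟶ E₀) (hE : E₀.dim = 1) (hψ : ψ₀ ≫ ψ₀ = -(d • 𝟙 E₀)) :
    ∃ (e : ProjectiveEmbedding (pad4Anchor E₀).X) (a : complexBetti (projectiveSpace e.n ℂ) 2)
      (w : complexBetti (pad4Anchor E₀).X (2 * 4)),
      IsRationalClass a ∧ a ≠ 0 ∧
      w ∈ weilClassesOf (pad4Anchor E₀) (pad4Action E₀ ψ₀) 4 d ∧ IsRationalClass w ∧ w ≠ 0 ∧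
      HasLciCarrierAt 4 (pad4Anchor E₀) (symH d (pad4Action E₀ ψ₀) e a) w :=
  exists_pad4_carrier_stubShape_of_kleimanSmoothing hKL hd hE hψ _ rfl

/-- **`stub_pad4_carrier` of the `d = 3` skeleton (crux `BlochSeedDiscThree`, every `√-3` CM anchor) MODULO KLEIMAN'S SMOOTHING**, in
that stub's own signature — the instance `d := 3` of `stub_pad4_carrier_of_kleimanSmoothing`.
[cite: Kleiman1969Grassmannians, §5] [cite: Schoen1998HodgeWeilAddendum, §10] [cite: Bloch1972Semiregularity, Remark (7.5)] -/
theorem stub_pad4_carrier_discThree_of_kleimanSmoothing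
    (hKL : Literature.AlgebraicGeometry.HodgeTheory.kleiman1969_smoothingCycles_eightfold_codimFour)
    (E₀ : AbelianVariety ℂ) (ψ₀ : E₀ ⟶ E₀) (hE : E₀.dim = 1) (hψ : ψ₀ ≫ ψ₀ = -(3 • 𝟙 E₀)) :
    ∃ (e : ProjectiveEmbedding (pad4Anchor E₀).X) (a : complexBetti (projectiveSpace e.n ℂ) 2)
      (w : complexBetti (pad4Anchor E₀).X (2 * 4)),
      IsRationalClass a ∧ a ≠ 0 ∧
      w ∈ weilClassesOf (pad4Anchor E₀) (pad4Action E₀ ψ₀) 4 3 ∧ IsRationalClass w ∧ w ≠ 0 ∧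
      HasLciCarrierAt 4 (pad4Anchor E₀) (symH 3 (pad4Action E₀ ψ₀) e a) w :=
  stub_pad4_carrier_of_kleimanSmoothing hKL 3 (by norm_num) E₀ ψ₀ hE hψ

/-- **On path**: a Bloch seed (the RUNG's currency) is an lci carrier, so — granted Kleiman's fact — the rung's only missing clause on
the delivered carrier is Bloch semiregularity; conversely nothing here produces a seed. Recorded as the implication
`HasBlochSeedAt ⟹ HasLciCarrierAt` in the Theorems vocabulary (verbatim the skeletons' `pad4_carrier_of_seedAt` step).
[cite: Bloch1972Semiregularity, Thm. (7.4) and Remark (7.5)] -/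
theorem hasLciCarrierAt_pad4_of_hasBlochSeedAt {d : ℕ} {E₀ : AbelianVariety ℂ} {ψ₀ : E₀ ⟶ E₀}
    {e : ProjectiveEmbedding (pad4Anchor E₀).X} {a : complexBetti (projectiveSpace e.n ℂ) 2}
    {w : complexBetti (pad4Anchor E₀).X (2 * 4)}
    (h : HasBlochSeedAt 4 (pad4Anchor E₀) (symH d (pad4Action E₀ ψ₀) e a) w) :
    HasLciCarrierAt 4 (pad4Anchor E₀) (symH d (pad4Action E₀ ψ₀) e a) w :=
  hasLciCarrierAt_of_hasBlochSeedAt h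

end Summit.HodgeConjecture.HodgeConjecture.Theorems

end
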